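import Summits.NavierStokesRegularity.NavierStokesRegularity.Theses.QuantisedSymmetry
import Summits.NavierStokesRegularity.NavierStokesRegularity.Theses.Blowup
import Summits.NavierStokesRegularity.NavierStokesRegularity.Theses.DssFarFieldSlaving
import Summits.NavierStokesRegularity.NavierStokesRegularity.Theorems.QuantisedSymmetryPolyhedralTruncationBridge
import Summits.NavierStokesRegularity.NavierStokesRegularity.Theorems.QuantisedSymmetryLiouvilleKillsProfile
import Summits.NavierStokesRegularity.NavierStokesRegularity.Theorems.DssFarFieldSlavingDssTruncationBridge

/-!
# Strategist sketch s22-g5 (family `-s`, independent census) for crux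
`QuantisedSymmetry.PolyhedralDssProfileExists` (stmt-NavierStokesRegularity-1404).

Typed companions of STRATEGY-CENSUS-s22.md.  Every `theorem` here is sorry-free and uses only
tree theorems; the `def`s are the candidate replacements / pieces examined in the census.
Nothing here is a route item.
-/

namespace Summit.NavierStokesRegularity.NavierStokesRegularity.Cruxes.PolyhedralDssProfileExists.CensusS22g5

open MeasureTheory
open Summit.NavierStokesRegularity.NavierStokesRegularity
open Summit.NavierStokesRegularity.NavierStokesRegularity.Theses.QuantisedSymmetry

local notation "E3" => EuclideanSpace ℝ (Fin 3)

/-! ## A. The crux alone already decides the summit (tree theorems only). -/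

/-- `X⁻ → ¬S` with the other two binders of `closes` discharged by landed theorems:
the bridge (stmt-11331) and Clay uniqueness (stmt-0153). -/
theorem crux_decides (hX : PolyhedralDssProfileExists) : ¬ _root_.NavierStokesRegularity :=
  closes hX Theorems.quantisedSymmetry_polyhedralTruncationBridge_proof ClayUniqueness_holds

/-! ## B. Weaker intermediates.

W1 = the sector-free hub (stmt-0155, `Blowup.BlowupTypeIDssProfile` =
`DssFarFieldSlaving.BlowupTypeIDssProfile`).  The crux implies it by forgetting `G`, and it
decides the summit by the landed general bridge — so replacing the crux by W1 is a re-target to an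
existing summit-deciding item, not a strategy. -/

theorem w1_of_crux (hX : PolyhedralDssProfileExists) : Theses.Blowup.BlowupTypeIDssProfile := by
  obtain ⟨G, -, -, -, c, hc, u, hanc, hmeas, hdss, hdec, -, hnt⟩ := hX
  intro h
  exact hnt ((h c).1 hc u hanc hmeas hdss hdec)

theorem w1_decides (hP : Theses.Blowup.BlowupTypeIDssProfile) : ¬ _root_.NavierStokesRegularity :=
  Theses.DssFarFieldSlaving.closes Theorems.dssTruncationBridge_proof hP

/-- W4 = `¬ PolyhedralTypeILiouville` (drop DSS, keep Type-I + G): strictly weaker than the crux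
(by the landed glue LiouvilleKillsProfile, contraposed) — but there is no ancient ⇒ blow-up
bridge, so it cannot replace `hX` in `closes`. -/
theorem w4_of_crux (hX : PolyhedralDssProfileExists) : ¬ PolyhedralTypeILiouville :=
  fun hL => Theorems.quantisedSymmetry_liouvilleKillsProfile_proof hL hX

/-! ## C. Decomposition attempt: abstract CAP / Newton–Kantorovich split.

S2 = an abstract a-posteriori fixed-point theorem (provable, no NS content);
S1 = "a certificate exists": a complete space, a map `T`, a centre and radii satisfying S2's
hypotheses, whose fixed points yield the profile.  The assembly `S1 → S2 → crux` is one line —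
and so is `crux → S1` (trivial certificate), i.e. ABSENT A CONCRETE NUMERICAL `T, x₀` the
certificate piece is the crux in costume.  A concrete certificate needs a candidate orbit, which
does not exist (census §Decomposition). -/

/-- S2: abstract contraction-in-a-ball step (radii-polynomial form). -/
def RadiiPolynomialStep : Prop :=
  ∀ (X : Type) [MetricSpace X] [CompleteSpace X] (T : X → X) (x₀ : X) (r Y Z : ℝ),
    0 ≤ r → 0 ≤ Y → 0 ≤ Z → Z < 1 → dist (T x₀) x₀ ≤ Y →
    (∀ x y, x ∈ Metric.closedBall x₀ r → y ∈ Metric.closedBall x₀ r →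
      dist (T x) (T y) ≤ Z * dist x y) →
    Y + Z * r ≤ r → ∃ x ∈ Metric.closedBall x₀ r, T x = x

/-- S1: existence of a certificate whose fixed points are polyhedral DSS profiles. -/
def CertificateExists : Prop :=
  ∃ (X : Type) (_ : MetricSpace X) (_ : CompleteSpace X) (T : X → X) (x₀ : X) (r Y Z : ℝ),
    0 ≤ r ∧ 0 ≤ Y ∧ 0 ≤ Z ∧ Z < 1 ∧ dist (T x₀) x₀ ≤ Y ∧
    (∀ x y, x ∈ Metric.closedBall x₀ r → y ∈ Metric.closedBall x₀ r →
      dist (T x) (T y) ≤ Z * dist x y) ∧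
    Y + Z * r ≤ r ∧ (∀ x ∈ Metric.closedBall x₀ r, T x = x → PolyhedralDssProfileExists)

/-- Assembly of the split (proved). -/
theorem crux_of_certificate (h1 : CertificateExists) (h2 : RadiiPolynomialStep) :
    PolyhedralDssProfileExists := by
  obtain ⟨X, _, _, T, x₀, r, Y, Z, hr, hY, hZ, hZ1, hres, hlip, hrad, hout⟩ := h1
  obtain ⟨x, hx, hfx⟩ := h2 X T x₀ r Y Z hr hY hZ hZ1 hres hlip hrad
  exact hout x hx hfx

/-- … and the converse: the abstract certificate piece is implied by the crux (trivial
certificate on the one-point space), so S1 ↔ crux modulo the provable S2 — a dictionary split. -/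
theorem certificate_of_crux (hX : PolyhedralDssProfileExists) : CertificateExists := by
  refine ⟨Unit, inferInstance, inferInstance, id, (), 0, 0, 0, le_rfl, le_rfl, le_rfl,
    zero_lt_one, by simp, ?_, by simp, fun _ _ _ => hX⟩
  intro x y _ _
  simp

/-! ## D. Strengthening attempt S⁺: pin the sector (icosahedral: an element of order 5) and a
λ-window.  `S⁺ → crux` is projection; the added rigidity is usable only AFTER a profile is in
hand (uniqueness / nondegeneracy arguments), never for existence. -/

def PolyhedralDssProfileExistsPinned : Prop :=
  ∃ G : Subgroup (E3 ≃ₗᵢ[ℝ] E3), Finite G ∧ (∃ g ∈ G, orderOf g = 5) ∧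
    (∀ g ∈ G, LinearMap.det (g.toLinearEquiv : E3 →ₗ[ℝ] E3) = 1) ∧
    (∀ V : Submodule ℝ E3, (∀ g ∈ G, ∀ v ∈ V, g v ∈ V) → V = ⊥ ∨ V = ⊤) ∧
    ∃ c : ℝ, 1 < c ∧ c ≤ 4 ∧ ∃ u : ℝ → E3 → E3,
      Literature.Analysis.FluidPDE.IsAncientMildSolution 1 u ∧
      (∀ t < 0, AEStronglyMeasurable (u t) volume) ∧
      Literature.Analysis.FluidPDE.IsDiscretelySelfSimilar c u ∧
      (∃ C₀ : ℝ, Literature.Analysis.FluidPDE.HasTypeIDecay C₀ u) ∧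
      (∀ g ∈ G, ∀ t x, u t (g x) = g (u t x)) ∧ ¬ (∀ t < 0, u t =ᵐ[volume] 0)

theorem crux_of_pinned (h : PolyhedralDssProfileExistsPinned) : PolyhedralDssProfileExists := by
  obtain ⟨G, hfin, -, hdet, hirr, c, hc, -, u, hanc, hmeas, hdss, hdec, heqv, hnt⟩ := h
  exact ⟨G, hfin, hdet, hirr, c, hc, u, hanc, hmeas, hdss, hdec, heqv, hnt⟩

/-! ## E. Negation = the polyhedral Type-I DSS Liouville statement; it is literally `¬ crux`
reorganised, and it follows from kill switch #3 (landed glue).  No weaker usable stub was found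
(census §Negation: the periodic head-pressure identity has the signless source `∂ₛP`). -/

def PolyhedralTypeIDssLiouville : Prop :=
  ∀ G : Subgroup (E3 ≃ₗᵢ[ℝ] E3), Finite G →
    (∀ g ∈ G, LinearMap.det (g.toLinearEquiv : E3 →ₗ[ℝ] E3) = 1) →
    (∀ V : Submodule ℝ E3, (∀ g ∈ G, ∀ v ∈ V, g v ∈ V) → V = ⊥ ∨ V = ⊤) →
    ∀ c : ℝ, 1 < c → ∀ u : ℝ → E3 → E3,
      Literature.Analysis.FluidPDE.IsAncientMildSolution 1 u →
      (∀ t < 0, AEStronglyMeasurable (u t) volume) →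
      Literature.Analysis.FluidPDE.IsDiscretelySelfSimilar c u →
      (∃ C₀ : ℝ, Literature.Analysis.FluidPDE.HasTypeIDecay C₀ u) →
      (∀ g ∈ G, ∀ t x, u t (g x) = g (u t x)) → ∀ t < 0, u t =ᵐ[volume] 0

theorem negation_iff : PolyhedralTypeIDssLiouville ↔ ¬ PolyhedralDssProfileExists := by
  constructor
  · rintro hL ⟨G, hfin, hdet, hirr, c, hc, u, hanc, hmeas, hdss, hdec, heqv, hnt⟩
    exact hnt (hL G hfin hdet hirr c hc u hanc hmeas hdss hdec heqv)
  · intro hN G hfin hdet hirr c hc u hanc hmeas hdss hdec heqv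
    by_contra hnt
    exact hN ⟨G, hfin, hdet, hirr, c, hc, u, hanc, hmeas, hdss, hdec, heqv, hnt⟩

theorem negation_of_killSwitch (hL : PolyhedralTypeILiouville) : PolyhedralTypeIDssLiouville :=
  negation_iff.mpr (Theorems.quantisedSymmetry_liouvilleKillsProfile_proof hL)

/-- The sector-free Liouville conjecture (Tsai Conj. 8.8–8.9, negation of hub 0155) also gives
the negation: the crux's negation is WEAKER than the open conjecture, the crux STRONGER than its
negation 0155 — the polyhedral sector sits strictly inside, with no tool separating it. -/
theorem negation_of_tsai (hT : Theses.Blowup.TypeIDssLiouville) : PolyhedralTypeIDssLiouville :=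
  negation_iff.mpr fun hX => w1_of_crux hX hT

end Summit.NavierStokesRegularity.NavierStokesRegularity.Cruxes.PolyhedralDssProfileExists.CensusS22g5
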